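import Mathlib
import Literature.NumberTheory.Irrationality.RhinViola2001.Theorem21Proofs
import Literature.NumberTheory.Irrationality.RhinViola2001.LevelFourPrimeDivisors
import Literature.NumberTheory.Transcendental.AperyIrrationality
import HarnessLib

/-!
# Rhin–Viola 2001, §5: prime divisors of `A_n = d_{Mn} d_{Nn} d_{Qn} a_n` from the transformation formula of ANY word of `Φ`

Topic `Literature/NumberTheory/Irrationality/RhinViola2001`. Typed-and-PROVED (no definition, no named fact; cell
`zeta5-irr`, seat zi-lit g11) from G. Rhin, C. Viola, *The group structure for ζ(3)*, Acta Arith. **97** (2001)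
269–293 [RhinViola2001], §5 pp. 287–289 (held text `paper:doi-10-4064-aa97-3-6`, read on the page).

The sibling `LevelFourPrimeDivisors.lean` (cell pub-zeta5, seat denom-lit g45, landed while this file was being
written) proves the printed chain (5.4)–(5.13) for the level-4 permutation `ϕϑ²ϕ`. The source adds (p. 287): "The 120
transformation formulae of the type (4.4) for `I_n`, where `ϱ` ranges over a full set of representatives of the left
cosets of `Θ` in `Φ`, give a wealth of information on the `p`-adic valuation of the integer `A_n = d_{Mn} d_{Nn} d_{Qn} a_n`",
and (p. 289) "The above discussion applies to any transformation formula corresponding to a permutation of level 4".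
THIS file proves the mechanism for EVERY word `ϱ` in the generators `ϕ, χ, ϑ, σ` (so for all 120 formulae at once),
with `I_n = I(hn, …, sn) = a_n + 2b_nζ(3)` (5.2), `M, N, Q` the successive maxima (5.3) of the sixteen integers `T`, and
`A_n` any integer value of `d_{Mn} d_{Nn} d_{Qn} a_n` (it exists: `Theorem21.theorem21_scale`):

* the group-theoretic bookkeeping for words (`ϱ` preserves (2.2)–(2.3), the maxima (5.3) and the multiset of the
  sixteen integers: `LevelFour.balanced_act`, `maxT_act`, `T_perm_act` of the tree), the total weight `h+⋯+s` (`total_act` — the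
  content of (5.9)–(5.10) `m′ + h′ = k + r`, `r′ + q′ = h + l` for a general word), and commutes with the scaling (5.2)
  (`scale_act`: `ϱ(P_n) = (ϱP)_n`, cf. (5.5));
* (5.6) for every word, "by the irrationality of `ζ(3)`" (the tree's `Apery.irrational_zeta_three`):
  `∏((ϱP)_n)! · a_n = ∏(P_n)! · a_n^{(ϱ)}` (`factProd_mul_a_eq`, from the tree's unconditional (4.4)
  `I_mul_factProd_act`), and (5.7) `∏((ϱP)_n)! · A_n = ∏(P_n)! · A′_n` with `A′_n ∈ ℤ` (`factProd_mul_A_eq`);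
* `p^{β_p − α_p} ∣ A_n` with `α_p = v_p(∏((ϱP)_n)!)`, `β_p = v_p(∏(P_n)!)` (`prime_pow_dvd_An`), and for `p > √(Mn)`
  (Legendre at `x < p²`, the tree's `RhinViola.padicValNat_factorial_of_lt_sq`):
  `β_p − α_p = Σ_{x ∈ P} [xω] − Σ_{x ∈ ϱP} [xω]`, `ω = {n/p}`, `[xω] = ⌊x (n mod p)/p⌋` (`padicVal_sub_eq_gain`), whence
  **`p^{Σ_{x∈P}[xω] − Σ_{x∈ϱP}[xω]} ∣ A_n`** (`prime_pow_gain_dvd`) — the general form of "any prime `p > √(Mn)` for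
  which `α_p − β_p < 0` … divides `A_n`, and any prime … for which `α_p − β_p = −2` … is such that `p²` divides `A_n`"
  ((5.12)–(5.13), whose level-4 instance is `LevelFour.prime_pow_dvd_An`).

What is NOT here: Lemma 4.1 of [4] (`|α_p − β_p| ≤ 2`), the coset census, `Ω_E, Ω′_E`, (5.14), Lemma 5.1, Theorem 5.1.

HONEST FRAMING (cells pub-zeta5 / zeta5-irr): the arithmetic of Rhin–Viola's `ζ(3)` approximations AS PRINTED in
2001; nothing here concerns `ζ(5)`; records in print unmoved.
-/

noncomputable section

namespace Literature.NumberTheory.Irrationality.RhinViola2001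

namespace Section5

open Theorem21
open LevelFour (aux_scale admissible_scale balanced_act_gen balanced_act maxT_act T_perm_act)
open Literature.NumberTheory.Transcendental (zetaValue)
open Literature.NumberTheory.Transcendental.Apery (irrational_zeta_three)
open Literature.NumberTheory.DiophantineApproximation.RhinViola (padicValNat_factorial_of_lt_sq mul_div_eq_mul_div_add)
open scoped Nat

/-! ### The group `Φ` on balanced parameters: balance, total weight, the maxima (5.3), scaling -/

/-- The total weight `h + ⋯ + s` is `Φ`-invariant (so that the sums of the parameters of `P` and of `ϱP` agree, which
is what makes `α_p − β_p` a difference of sums of `[xω]`, cf. (5.9)–(5.10)). [cite: RhinViola2001, §5 p. 289 ((5.9), (5.10))] -/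
theorem total_act (w : List Gen) {P : Params} (hB : P.Balanced) : total (act w P) = total P := by
  induction w with
  | nil => rfl
  | cons g w ih =>
    have hB' : (act w P).Balanced := balanced_act w hB
    obtain ⟨h1, h2⟩ := hB'
    show total (g.act (act w P)) = total P
    rw [← ih]
    cases g
    · simp only [Gen.act, phi, total, Params.aux]; omega
    · simp only [Gen.act, chi, total, Params.aux]; omega
    · exact total_theta _
    · exact total_sigma _

/-- The generators commute with the scaling `(h, …, s) ↦ (hn, …, sn)` of (5.2). [cite: RhinViola2001, §5 (5.2), (5.5)] -/
theorem scale_act_gen (g : Gen) (P : Params) (n : ℤ) : g.act (P.scale n) = (g.act P).scale n := by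
  cases g <;> ext <;> simp only [Gen.act, phi, chi, theta, sigma, Params.scale, Params.aux] <;> ring

/-- Words commute with the scaling (5.2): `ϱ(P_n) = (ϱP)_n` ("`I′_n = I(m′n, r′n, mn, h′n, qn, q′n, sn, jn)`", (5.5)).
[cite: RhinViola2001, §5 (5.5)] -/
theorem scale_act (w : List Gen) (P : Params) (n : ℤ) : act w (P.scale n) = (act w P).scale n := by
  induction w with
  | nil => rfl
  | cons g w ih =>
    show g.act (act w (P.scale n)) = (g.act (act w P)).scale n
    rw [ih, scale_act_gen]

/-- Every one of the sixteen integers is at most `M = max T`. [cite: RhinViola2001, §5 (5.3)] -/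
theorem le_maxT_of_mem {P : Params} {x : ℤ} (hx : x ∈ P.T) : x ≤ maxT P 0 := by
  have hD := dom_succMax P.T (by rw [length_T]; norm_num)
  have h := (List.countP_eq_zero.1 hD.1) x hx
  unfold maxT
  simpa using h

/-- The eight parameters of `ϱP` are at most `M = max T` (they are among the sixteen integers of `ϱP`, a permutation of
those of `P`). [cite: RhinViola2001, §5 (5.3), (5.8)] -/
theorem params_le_maxT (w : List Gen) {P : Params} (hB : P.Balanced) :
    ∀ x ∈ (act w P).toList, x ≤ maxT P 0 := by
  intro x hx
  have hxT : x ∈ (act w P).T := by rw [Params.T]; exact List.mem_append_left _ hx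
  exact le_maxT_of_mem ((T_perm_act w hB).subset hxT)

/-! ### (5.6): splitting by the irrationality of `ζ(3)` -/

/-- "whence, by the irrationality of `ζ(3)`": `a + 2bζ(3) = a′ + 2b′ζ(3)` with rational `a, a′, b, b′` forces `a = a′`.
[cite: RhinViola2001, §5 (5.6)] -/
theorem rat_eq_of_add_zeta_three {a a' b b' : ℚ}
    (h : (a : ℝ) + 2 * b * zetaValue 3 = a' + 2 * b' * zetaValue 3) : a = a' := by
  by_contra hne
  by_cases hb : b = b'
  · rw [hb] at h
    have : (a : ℝ) = a' := by linarith
    exact hne (by exact_mod_cast this)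
  · have hb2 : (2 : ℝ) * b' - 2 * b ≠ 0 := by
      have : (b' : ℝ) ≠ b := by exact_mod_cast (Ne.symm hb)
      intro h0; apply this; linarith
    have hz : zetaValue 3 = ((a : ℝ) - a') / (2 * b' - 2 * b) := by
      rw [eq_div_iff hb2]
      linear_combination -h
    apply irrational_zeta_three
    refine ⟨(a - a') / (2 * b' - 2 * b), ?_⟩
    rw [hz]
    push_cast
    ring

/-- **(5.6) for every word `ϱ` of `Φ`.** For admissible `P`, `n ≥ 0` and the rational parts `a_n` of `I(P_n)` and
`a_n^{(ϱ)}` of `I((ϱP)_n)`: `∏((ϱP)_n)! · a_n = ∏(P_n)! · a_n^{(ϱ)}` — printed for `ϱ = ϕϑ²ϕ`: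
"`(m′n)!(r′n)!(h′n)!(q′n)! a_n = (hn)!(kn)!(ln)!(rn)! a′_n`". [cite: RhinViola2001, §5 (5.4)–(5.6)] -/
theorem factProd_mul_a_eq {P : Params} (hP : P.Admissible) (w : List Gen) (n : ℕ) {a a' : ℚ} {b b' : ℤ}
    (ha : I (P.scale n) = a + 2 * b * zetaValue 3) (ha' : I ((act w P).scale n) = a' + 2 * b' * zetaValue 3) :
    (factProd ((act w P).scale n) : ℚ) * a = factProd (P.scale n) * a' := by
  have hPn : (P.scale n).Admissible := admissible_scale hP (by positivity)
  have key := I_mul_factProd_act w hPn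
  rw [scale_act, ha, ha'] at key
  -- `(a + 2bζ)·c = (a' + 2b'ζ)·c'`: compare rational parts
  have h := rat_eq_of_add_zeta_three (a := (factProd ((act w P).scale n) : ℚ) * a)
    (a' := (factProd (P.scale n) : ℚ) * a') (b := (factProd ((act w P).scale n) : ℚ) * b)
    (b' := (factProd (P.scale n) : ℚ) * b') (by push_cast; linear_combination key)
  exact h

/-- **(5.7)**: "Multiplying (5.6) by `d_{Mn} d_{Nn} d_{Qn}` we obtain `(m′n)!(r′n)!(h′n)!(q′n)! A_n =
(hn)!(kn)!(ln)!(rn)! A′_n`, where `A_n = d_{Mn} d_{Nn} d_{Qn} a_n` and `A′_n = d_{Mn} d_{Nn} d_{Qn} a′_n` are integers by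
(5.3) and Theorem 2.1" — for every word `ϱ`: the integer `A_n` (any integer value of `d_{Mn} d_{Nn} d_{Qn} a_n`)
satisfies `∏((ϱP)_n)! · A_n = ∏(P_n)! · A′_n` for SOME integer `A′_n`. [cite: RhinViola2001, §5 (5.7)] -/
theorem factProd_mul_A_eq {P : Params} (hP : P.Admissible) (w : List Gen) {n : ℕ} (hn : 1 ≤ n) {a : ℚ} {b : ℤ}
    (ha : I (P.scale n) = a + 2 * b * zetaValue 3) {A : ℤ}
    (hA : ((d (n * maxT P 0) * d (n * maxT P 1) * d (n * maxT P 2) : ℕ) : ℚ) * a = A) :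
    ∃ A' : ℤ, (factProd ((act w P).scale n) : ℤ) * A = factProd (P.scale n) * A' := by
  obtain ⟨a', b', ha', A', hA'⟩ :=
    theorem21_scale (act w P) (admissible_act w hP).2.1 (admissible_act w hP).1 hn
  rw [maxT_act w hP.1, maxT_act w hP.1, maxT_act w hP.1] at hA'
  refine ⟨A', ?_⟩
  have h := factProd_mul_a_eq hP w n ha ha'
  set D : ℕ := d (n * maxT P 0) * d (n * maxT P 1) * d (n * maxT P 2) with hD
  have h2 : (factProd ((act w P).scale n) : ℚ) * ((D : ℚ) * a) = factProd (P.scale n) * ((D : ℚ) * a') := by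
    rw [← mul_assoc, mul_comm _ (D : ℚ), mul_assoc, h]; ring
  rw [hA, hA'] at h2
  exact_mod_cast h2

/-! ### `v_p(A_n) ≥ β_p − α_p` -/

/-- From `c · A = c′ · A′` in `ℤ` with `c, c′ ≥ 1`: `p^{v_p(c′) − v_p(c)} ∣ A` ("removing from (5.7) the primes …
dividing the factorials on both sides"). [cite: RhinViola2001, §5 (5.7)–(5.11)] -/
theorem prime_pow_padicVal_sub_dvd {p : ℕ} [hp : Fact p.Prime] {c c' : ℕ} (hc : c ≠ 0) (hc' : c' ≠ 0) {A A' : ℤ}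
    (h : (c : ℤ) * A = c' * A') : (p : ℤ) ^ (padicValNat p c' - padicValNat p c) ∣ A := by
  rw [padicValInt_dvd_iff]
  by_cases hA : A = 0
  · exact Or.inl hA
  right
  have hA' : A' ≠ 0 := by
    intro h0
    rw [h0, mul_zero] at h
    rcases mul_eq_zero.1 h with h1 | h1
    · exact hc (by exact_mod_cast h1)
    · exact hA h1
  have hv := congrArg (padicValInt p) h
  rw [padicValInt.mul (by exact_mod_cast hc) hA, padicValInt.mul (by exact_mod_cast hc') hA',
    padicValInt.of_nat, padicValInt.of_nat] at hv
  omega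

/-- **`p^{β_p − α_p} ∣ A_n`** for every word `ϱ`, with `α_p = v_p(∏((ϱP)_n)!)`, `β_p = v_p(∏(P_n)!)`
("`α_p = v_p((m′n)!(r′n)!(h′n)!(q′n)!)`, `β_p = v_p((hn)!(kn)!(ln)!(rn)!)`" for `ϕϑ²ϕ`, the common factorials
`(jn)!(mn)!(qn)!(sn)!` contributing equally to both). [cite: RhinViola2001, §5 p. 288 (definition of α_p, β_p) and (5.11)] -/
theorem prime_pow_dvd_An {P : Params} (hP : P.Admissible) (w : List Gen) {n : ℕ} (hn : 1 ≤ n) {p : ℕ}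
    [Fact p.Prime] {a : ℚ} {b : ℤ} (ha : I (P.scale n) = a + 2 * b * zetaValue 3) {A : ℤ}
    (hA : ((d (n * maxT P 0) * d (n * maxT P 1) * d (n * maxT P 2) : ℕ) : ℚ) * a = A) :
    (p : ℤ) ^ (padicValNat p (factProd (P.scale n)) - padicValNat p (factProd ((act w P).scale n))) ∣ A := by
  obtain ⟨A', h⟩ := factProd_mul_A_eq hP w hn ha hA
  have h1 : factProd ((act w P).scale n) ≠ 0 := by unfold factProd; positivity
  have h2 : factProd (P.scale n) ≠ 0 := by unfold factProd; positivity
  exact prime_pow_padicVal_sub_dvd h1 h2 h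

/-! ### Legendre's formula for `p > √(Mn)` -/

/-- A parameter of `P_n` as a natural number: `(n x).toNat = n · x.toNat` for `x ≥ 0`. [cite: RhinViola2001, §5 (5.2)] -/
private theorem toNat_natCast_mul {x : ℤ} (hx : 0 ≤ x) (n : ℕ) : ((n : ℤ) * x).toNat = n * x.toNat := by
  obtain ⟨k, rfl⟩ := Int.eq_ofNat_of_zero_le hx
  rw [← Nat.cast_mul, Int.toNat_natCast, Int.toNat_natCast]

/-- `v_p` of a product of two positive naturals. [folklore] -/
private theorem padicValNat_mul' {p a b : ℕ} [Fact p.Prime] (ha : a ≠ 0) (hb : b ≠ 0) :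
    padicValNat p (a * b) = padicValNat p a + padicValNat p b :=
  padicValNat.mul ha hb

/-- **Legendre for `p > √(Mn)`**: `β_p = v_p(∏(P_n)!) = Σ_x [xn/p]` over the eight parameters `x` of `P`, when every
`xn < p²`. [cite: RhinViola2001, §5 (5.8) and p. 289] -/
theorem padicValNat_factProd_scale {P : Params} (hN : P.Nonneg) (n : ℕ) {p : ℕ} [Fact p.Prime]
    (hlt : ∀ x ∈ P.toList, x.toNat * n < p ^ 2) :
    padicValNat p (factProd (P.scale n)) = (P.toList.map fun x => x.toNat * n / p).sum := by
  obtain ⟨h0, h1, h2, h3, h4, h5, h6, h7⟩ := hN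
  simp only [Params.toList, List.mem_cons, List.not_mem_nil, or_false, forall_eq_or_imp, forall_eq] at hlt
  obtain ⟨l0, l1, l2, l3, l4, l5, l6, l7⟩ := hlt
  have hf : ∀ m : ℕ, m ! ≠ 0 := fun m => Nat.factorial_ne_zero m
  have hf2 : ∀ a b : ℕ, a ≠ 0 → b ≠ 0 → a * b ≠ 0 := fun a b ha hb => Nat.mul_ne_zero ha hb
  simp only [factProd, Params.scale, toNat_natCast_mul h0, toNat_natCast_mul h1, toNat_natCast_mul h2,
    toNat_natCast_mul h3, toNat_natCast_mul h4, toNat_natCast_mul h5, toNat_natCast_mul h6, toNat_natCast_mul h7,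
    Params.toList, List.map_cons, List.map_nil, List.sum_cons, List.sum_nil]
  rw [padicValNat_mul' (by apply_rules) (hf _), padicValNat_mul' (by apply_rules) (hf _),
    padicValNat_mul' (by apply_rules) (hf _), padicValNat_mul' (by apply_rules) (hf _),
    padicValNat_mul' (by apply_rules) (hf _), padicValNat_mul' (by apply_rules) (hf _),
    padicValNat_mul' (hf _) (hf _)]
  rw [padicValNat_factorial_of_lt_sq (by rw [mul_comm]; exact l0),
    padicValNat_factorial_of_lt_sq (by rw [mul_comm]; exact l1),
    padicValNat_factorial_of_lt_sq (by rw [mul_comm]; exact l2),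
    padicValNat_factorial_of_lt_sq (by rw [mul_comm]; exact l3),
    padicValNat_factorial_of_lt_sq (by rw [mul_comm]; exact l4),
    padicValNat_factorial_of_lt_sq (by rw [mul_comm]; exact l5),
    padicValNat_factorial_of_lt_sq (by rw [mul_comm]; exact l6),
    padicValNat_factorial_of_lt_sq (by rw [mul_comm]; exact l7)]
  simp only [mul_comm n]
  ring

/-- The sum `Σ_x [xn/p]` over the eight parameters splits as `[n/p]·Σ_x x + Σ_x [xω]`.
[cite: RhinViola2001, §5 p. 289] -/
theorem sum_mul_div_eq (P : Params) (n p : ℕ) (hp : 0 < p) :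
    (P.toList.map fun x => x.toNat * n / p).sum =
      (n / p) * (P.toList.map fun x => x.toNat).sum + (P.toList.map fun x => x.toNat * (n % p) / p).sum := by
  simp only [Params.toList, List.map_cons, List.map_nil, List.sum_cons, List.sum_nil, mul_div_eq_mul_div_add _ n hp]
  ring

/-- The sum of the eight parameters (as natural numbers) is the total weight. [cite: RhinViola2001, §5 (5.9)–(5.10)] -/
theorem sum_toNat_eq_total {P : Params} (hN : P.Nonneg) :
    (((P.toList.map fun x => x.toNat).sum : ℕ) : ℤ) = total P := by
  obtain ⟨h0, h1, h2, h3, h4, h5, h6, h7⟩ := hN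
  simp only [Params.toList, List.map_cons, List.map_nil, List.sum_cons, List.sum_nil, total]
  push_cast
  rw [Int.toNat_of_nonneg h0, Int.toNat_of_nonneg h1, Int.toNat_of_nonneg h2, Int.toNat_of_nonneg h3,
    Int.toNat_of_nonneg h4, Int.toNat_of_nonneg h5, Int.toNat_of_nonneg h6, Int.toNat_of_nonneg h7]
  ring

/-- **"`α_p − β_p = [m′ω] + [r′ω] + [h′ω] + [q′ω] − [hω] − [kω] − [lω] − [rω]`"** (p. 289), for every word `ϱ` and
`p > √(Mn)`: `β_p − α_p = Σ_{x ∈ P} [xω] − Σ_{x ∈ ϱP} [xω]` (`[xω] = ⌊x(n mod p)/p⌋`; truncated subtraction of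
natural numbers on both sides). [cite: RhinViola2001, §5 (5.8) and p. 289] -/
theorem padicVal_sub_eq_gain {P : Params} (hP : P.Admissible) (w : List Gen) (n : ℕ) {p : ℕ} [hp : Fact p.Prime]
    (hpM : (maxT P 0).toNat * n < p ^ 2) :
    padicValNat p (factProd (P.scale n)) - padicValNat p (factProd ((act w P).scale n)) =
      (P.toList.map fun x => x.toNat * (n % p) / p).sum -
        ((act w P).toList.map fun x => x.toNat * (n % p) / p).sum := by
  have hB := hP.1
  have hN := hP.2.1
  have hN' := (admissible_act w hP).2.1
  have hbound : ∀ x : ℤ, x ≤ maxT P 0 → x.toNat * n < p ^ 2 := by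
    intro x hx
    have : x.toNat ≤ (maxT P 0).toNat := Int.toNat_le_toNat hx
    calc x.toNat * n ≤ (maxT P 0).toNat * n := Nat.mul_le_mul_right n this
      _ < p ^ 2 := hpM
  have hltP : ∀ x ∈ P.toList, x.toNat * n < p ^ 2 := fun x hx =>
    hbound x (params_le_maxT [] hB x hx)
  have hltW : ∀ x ∈ (act w P).toList, x.toNat * n < p ^ 2 := fun x hx =>
    hbound x (params_le_maxT w hB x hx)
  rw [padicValNat_factProd_scale hN n hltP, padicValNat_factProd_scale hN' n hltW,
    sum_mul_div_eq P n p hp.out.pos, sum_mul_div_eq (act w P) n p hp.out.pos]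
  have hsum : (P.toList.map fun x => x.toNat).sum = ((act w P).toList.map fun x => x.toNat).sum := by
    have h := sum_toNat_eq_total hN
    have h' := sum_toNat_eq_total hN'
    rw [total_act w hB] at h'
    exact_mod_cast h.trans h'.symm
  rw [hsum]
  omega

/-! ### (5.12), (5.13): primes `p > √(Mn)` dividing `A_n` -/

/-- **The `p`-adic gain from a transformation formula** (every word `ϱ` of `Φ`): for admissible `P`, `n ≥ 1`, a prime
`p` with `p² > Mn`, `I(P_n) = a_n + 2b_nζ(3)` and any integer value `A_n` of `d_{Mn} d_{Nn} d_{Qn} a_n`,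
`p^{Σ_{x ∈ P}[xω] − Σ_{x ∈ ϱP}[xω]} ∣ A_n` — "any prime `p > √(Mn)` for which `α_p − β_p < 0` … divides `A_n`, and any
prime `p > √(Mn)` for which `α_p − β_p = −2` … is such that `p²` divides `A_n`".
[cite: RhinViola2001, §5 (5.11)–(5.13), p. 289] -/
theorem prime_pow_gain_dvd {P : Params} (hP : P.Admissible) (w : List Gen) {n : ℕ} (hn : 1 ≤ n) {p : ℕ}
    [Fact p.Prime] (hpM : (maxT P 0).toNat * n < p ^ 2) {a : ℚ} {b : ℤ}
    (ha : I (P.scale n) = a + 2 * b * zetaValue 3) {A : ℤ}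
    (hA : ((d (n * maxT P 0) * d (n * maxT P 1) * d (n * maxT P 2) : ℕ) : ℚ) * a = A) :
    (p : ℤ) ^ ((P.toList.map fun x => x.toNat * (n % p) / p).sum -
        ((act w P).toList.map fun x => x.toNat * (n % p) / p).sum) ∣ A := by
  rw [← padicVal_sub_eq_gain hP w n hpM]
  exact prime_pow_dvd_An hP w hn ha hA

end Section5

end Literature.NumberTheory.Irrationality.RhinViola2001

end
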